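import Summits.AtomisticToContinuum.Crystallization.Theorems.DisclinationRationUniformPolytypeStabilityFarDefs

/-!
# `UniformPolytypeStability` (stmt-AtomisticToContinuum-15800), line `birth` (v3, cells / far field): chain identity, I

Route `DisclinationRation`, crux `UniformPolytypeStability`, line `birth` (lead prover-line-stmt-AtomisticToContinuum-15800-0).
First helper file of the stubs `stub_chainIdentity` / `stub_planeChainIdentity` (SOUNDNESS of the rational chain
checker `FarChain.checkSteep` / `FarChain.checkPlane` of `…FarChains.lean`): the pure bookkeeping part, over an
arbitrary real vector space `V` of values.

* REAL EVALUATION of a functional `f : Fnl` (a list of (point, rational weight)) against a point valuation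
  `φ : ℤ³ → V`: `eval φ f = Σ w • φ p`; the total weight `wt f p` of a point; `eval` through `wt`
  (`eval_eq_sum_wt`).
* `Fnl.addPt`, `Fnl.norm` preserve total weights and produce duplicate-free keys (`addPt_spec`, `norm_spec`), hence
  the KEY LEMMA `eval_eq_of_beq`: `Fnl.beq f g = true → eval φ f = eval φ g` (the normal forms include each other,
  duplicate-free keyed lists that include each other have equal total weights).
* The AFFINE INTERPOLANT: `eval φ (tetFnl N t μ') − eval φ (tetFnl N t μ) = Σ_{(v,ĝ) ∈ subTet t} ⟨ĝ, μ' − μ⟩ • φ(corner v of N)`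
  (`eval_tetFnl_sub`; the barycentric forms of `bary` are affine with the listed gradients).
* TELESCOPING inside a slab from `checkPieces` (`pieces_telescope`): the consecutive `Fnl.beq` junction checks give
  `Σ_pieces (A_p(s₁) − A_p(s₀)) = eval (exitFnl) − eval (entryFnl)`.

Only what the checks certify about a piece list is used, never how `marchSlab` produced it.  Everything is
`[folklore]`; helper lemmas live in the sub-namespace `StubChain`; the registered anchor is `stub_chainIdentityAux1`.
-/

noncomputable section

namespace Summit.AtomisticToContinuum.Crystallization.Theorems.UniformPolytypeStabilityCells

open scoped BigOperators
open FarChain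

namespace StubChain

variable {V : Type*} [AddCommGroup V] [Module ℝ V]

/-! ## Keys, total weights, real evaluation -/

/-- The list of points (keys) of a functional. [folklore] -/
def keys (f : Fnl) : List (ℤ × ℤ × ℤ) := f.map Prod.fst

/-- The total weight of the point `p` in the functional `f`. [folklore] -/
def wt (f : Fnl) (p : ℤ × ℤ × ℤ) : ℚ := (f.map fun q => if q.1 = p then q.2 else 0).sum

/-- The real evaluation `Σ_{(p, w) ∈ f} w • φ p` of a functional against a point valuation `φ`. [folklore] -/
def eval (φ : ℤ × ℤ × ℤ → V) (f : Fnl) : V := (f.map fun q => (q.2 : ℝ) • φ q.1).sum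

/-- Keys of a cons. [folklore] -/
@[simp] theorem keys_cons (q : (ℤ × ℤ × ℤ) × ℚ) (f : Fnl) : keys (q :: f) = q.1 :: keys f := rfl

/-- Keys of the empty functional. [folklore] -/
@[simp] theorem keys_nil : keys [] = [] := rfl

/-- Total weight in the empty functional. [folklore] -/
@[simp] theorem wt_nil (p : ℤ × ℤ × ℤ) : wt [] p = 0 := rfl

/-- Total weight of a cons. [folklore] -/
@[simp] theorem wt_cons (q : (ℤ × ℤ × ℤ) × ℚ) (f : Fnl) (p : ℤ × ℤ × ℤ) :
    wt (q :: f) p = (if q.1 = p then q.2 else 0) + wt f p := by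
  simp [wt]

/-- Evaluation of the empty functional. [folklore] -/
@[simp] theorem eval_nil (φ : ℤ × ℤ × ℤ → V) : eval φ [] = 0 := by
  simp [eval]

/-- Evaluation of a cons. [folklore] -/
@[simp] theorem eval_cons (φ : ℤ × ℤ × ℤ → V) (q : (ℤ × ℤ × ℤ) × ℚ) (f : Fnl) :
    eval φ (q :: f) = (q.2 : ℝ) • φ q.1 + eval φ f := by
  simp [eval]

/-- Evaluation of a singleton of weight one. [folklore] -/
theorem eval_single (φ : ℤ × ℤ × ℤ → V) (p : ℤ × ℤ × ℤ) : eval φ [(p, 1)] = φ p := by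
  simp [eval]

/-- Relabelling the points of a functional composes the valuation. [folklore] -/
theorem eval_map (φ : ℤ × ℤ × ℤ → V) (ψ : ℤ × ℤ × ℤ → ℤ × ℤ × ℤ) (f : Fnl) :
    eval φ (f.map fun q => (ψ q.1, q.2)) = eval (fun p => φ (ψ p)) f := by
  simp [eval, List.map_map, Function.comp_def]

/-- Evaluation of `toSites l σ K f` against a valuation of absolute site offsets. [folklore] -/
theorem eval_toSites (φ : ℤ × ℤ × ℤ → V) (l : ℕ) (σ : Bool) (K : ℤ) (f : Fnl) :
    eval φ (toSites l σ K f) =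
      eval (fun p => φ ((l : ℤ) + p.2.2, sgnZ σ * p.1 - K, sgnZ σ * p.2.1 - K)) f := by
  unfold toSites
  exact eval_map φ (fun p => ((l : ℤ) + p.2.2, sgnZ σ * p.1 - K, sgnZ σ * p.2.1 - K)) f

/-- Evaluation through total weights: `eval φ f = Σ_{p ∈ S} (wt f p) • φ p` for every finite `S ⊇ keys f`. [folklore] -/
theorem eval_eq_sum_wt (φ : ℤ × ℤ × ℤ → V) (f : Fnl) (S : Finset (ℤ × ℤ × ℤ)) (hS : ∀ q ∈ f, q.1 ∈ S) :
    eval φ f = ∑ p ∈ S, (wt f p : ℝ) • φ p := by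
  induction f with
  | nil => simp
  | cons q f ih =>
    rw [eval_cons, ih fun q' hq' => hS q' (List.mem_cons_of_mem _ hq')]
    simp only [wt_cons, Rat.cast_add, add_smul, Finset.sum_add_distrib, add_left_inj]
    rw [Finset.sum_eq_single_of_mem q.1 (hS q List.mem_cons_self)]
    · simp
    · intro p _ hp
      simp [Ne.symm hp]

/-- An absent key has total weight zero. [folklore] -/
theorem wt_eq_zero_of_not_mem (f : Fnl) (p : ℤ × ℤ × ℤ) (h : p ∉ keys f) : wt f p = 0 := by
  induction f with
  | nil => rfl
  | cons q f ih =>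
    simp only [keys_cons, List.mem_cons, not_or] at h
    rw [wt_cons, if_neg (fun e => h.1 e.symm), ih h.2, add_zero]

/-- With duplicate-free keys, the total weight of a listed point is its listed weight. [folklore] -/
theorem wt_eq_of_mem (f : Fnl) (hf : (keys f).Nodup) (q : (ℤ × ℤ × ℤ) × ℚ) (hq : q ∈ f) : wt f q.1 = q.2 := by
  induction f with
  | nil => cases hq
  | cons r f ih =>
    simp only [keys_cons, List.nodup_cons] at hf
    rcases List.mem_cons.1 hq with rfl | hq
    · rw [wt_cons, if_pos rfl, wt_eq_zero_of_not_mem f _ hf.1, add_zero]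
    · have hne : r.1 ≠ q.1 := fun e => hf.1 (e ▸ List.mem_map.2 ⟨q, hq, rfl⟩)
      rw [wt_cons, if_neg hne, ih hf.2 hq, zero_add]

/-- Two duplicate-free keyed functionals that include each other have the same total weights. [folklore] -/
theorem wt_eq_of_subset (f g : Fnl) (hf : (keys f).Nodup) (hg : (keys g).Nodup)
    (h₁ : ∀ q ∈ f, q ∈ g) (h₂ : ∀ q ∈ g, q ∈ f) (p : ℤ × ℤ × ℤ) : wt f p = wt g p := by
  by_cases hp : p ∈ keys f
  · obtain ⟨q, hq, rfl⟩ := List.mem_map.1 hp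
    rw [wt_eq_of_mem f hf q hq, wt_eq_of_mem g hg q (h₁ q hq)]
  · have hp' : p ∉ keys g := fun hp' => by
      obtain ⟨q, hq, rfl⟩ := List.mem_map.1 hp'
      exact hp (List.mem_map.2 ⟨q, h₂ q hq, rfl⟩)
    rw [wt_eq_zero_of_not_mem f p hp, wt_eq_zero_of_not_mem g p hp']

/-! ## `addPt`, `norm`, `beq` -/

/-- `addPt` past a head with a different key. [folklore] -/
theorem addPt_cons_of_ne (q : (ℤ × ℤ × ℤ) × ℚ) (f : Fnl) (p : ℤ × ℤ × ℤ) (w : ℚ) (h : q.1 ≠ p) :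
    Fnl.addPt (q :: f) p w = q :: Fnl.addPt f p w := by
  unfold Fnl.addPt
  simp only [List.any_cons, h, decide_false, Bool.false_or]
  split_ifs <;> simp [h]

/-- `addPt` at a head with the same key, the key being absent from the tail. [folklore] -/
theorem addPt_cons_of_eq (q : (ℤ × ℤ × ℤ) × ℚ) (f : Fnl) (w : ℚ) (h : q.1 ∉ keys f) :
    Fnl.addPt (q :: f) q.1 w = (q.1, q.2 + w) :: f := by
  unfold Fnl.addPt
  simp only [List.any_cons, decide_true, Bool.true_or, if_true, List.map_cons]
  congr 1
  conv_rhs => rw [← List.map_id f]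
  refine List.map_congr_left fun r hr => ?_
  have : r.1 ≠ q.1 := fun e => h (e ▸ List.mem_map.2 ⟨r, hr, rfl⟩)
  simp [this]

/-- `addPt f p w` on a duplicate-free keyed `f`: keys stay duplicate-free, lie in `keys f ∪ {p}`, and the total
weight of `p` grows by `w` (others unchanged). [folklore] -/
theorem addPt_spec (f : Fnl) (hf : (keys f).Nodup) (p : ℤ × ℤ × ℤ) (w : ℚ) :
    (keys (Fnl.addPt f p w)).Nodup ∧ (∀ p', p' ∈ keys (Fnl.addPt f p w) → p' ∈ keys f ∨ p' = p) ∧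
      ∀ p', wt (Fnl.addPt f p w) p' = wt f p' + if p = p' then w else 0 := by
  induction f with
  | nil =>
    refine ⟨by simp [Fnl.addPt, keys], by simp [Fnl.addPt, keys], fun p' => ?_⟩
    simp [Fnl.addPt, wt]
  | cons q f ih =>
    have hf' : q.1 ∉ keys f ∧ (keys f).Nodup := by simpa using hf
    by_cases h : q.1 = p
    · subst h
      rw [addPt_cons_of_eq q f w hf'.1]
      refine ⟨by simpa using hf, fun p' hp' => ?_, fun p' => ?_⟩
      · simp only [keys_cons, List.mem_cons] at hp' ⊢
        tauto
      · simp only [wt_cons]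
        split_ifs <;> ring
    · rw [addPt_cons_of_ne q f p w h]
      obtain ⟨ih1, ih2, ih3⟩ := ih hf'.2
      refine ⟨?_, fun p' hp' => ?_, fun p' => ?_⟩
      · simp only [keys_cons, List.nodup_cons]
        refine ⟨fun hq => ?_, ih1⟩
        rcases ih2 _ hq with hq | hq
        · exact hf'.1 hq
        · exact h hq
      · simp only [keys_cons, List.mem_cons] at hp' ⊢
        rcases hp' with hp' | hp'
        · exact Or.inl (Or.inl hp')
        · rcases ih2 _ hp' with h' | h'
          · exact Or.inl (Or.inr h')
          · exact Or.inr h'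
      · rw [wt_cons, wt_cons, ih3]
        ring

/-- Folding `addPt` over a list adds its total weights and keeps keys duplicate-free. [folklore] -/
theorem foldl_addPt_spec (l acc : Fnl) (hacc : (keys acc).Nodup) :
    (keys (l.foldl (fun a q => Fnl.addPt a q.1 q.2) acc)).Nodup ∧
      ∀ p, wt (l.foldl (fun a q => Fnl.addPt a q.1 q.2) acc) p = wt acc p + wt l p := by
  induction l generalizing acc with
  | nil => simpa using hacc
  | cons q l ih =>
    simp only [List.foldl_cons]
    obtain ⟨h1, -, h2⟩ := addPt_spec acc hacc q.1 q.2
    obtain ⟨h3, h4⟩ := ih _ h1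
    refine ⟨h3, fun p => ?_⟩
    rw [h4, h2, wt_cons]
    ring

/-- Dropping zero weights does not change total weights. [folklore] -/
theorem wt_filter (g : Fnl) (p : ℤ × ℤ × ℤ) : wt (g.filter fun q => q.2 ≠ 0) p = wt g p := by
  induction g with
  | nil => rfl
  | cons q g ih =>
    rw [List.filter_cons]
    split_ifs with h
    · rw [wt_cons, wt_cons, ih]
    · have h0 : q.2 = 0 := by simpa using h
      rw [ih, wt_cons, h0, ite_self, zero_add]

/-- The normal form has duplicate-free keys and the same total weights. [folklore] -/
theorem norm_spec (f : Fnl) : (keys (Fnl.norm f)).Nodup ∧ ∀ p, wt (Fnl.norm f) p = wt f p := by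
  obtain ⟨h1, h2⟩ := foldl_addPt_spec f [] (by simp)
  refine ⟨h1.sublist ?_, fun p => ?_⟩
  · unfold Fnl.norm keys
    exact List.filter_sublist.map _
  · unfold Fnl.norm
    rw [wt_filter, h2, wt_nil, zero_add]

/-- `Fnl.beq` is sound for total weights. [folklore] -/
theorem wt_eq_of_beq (f g : Fnl) (h : Fnl.beq f g = true) (p : ℤ × ℤ × ℤ) : wt f p = wt g p := by
  obtain ⟨hf1, hf2⟩ := norm_spec f
  obtain ⟨hg1, hg2⟩ := norm_spec g
  simp only [Fnl.beq, Bool.and_eq_true, List.all_eq_true, List.any_eq_true, decide_eq_true_eq,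
    exists_eq_right] at h
  rw [← hf2, ← hg2]
  exact wt_eq_of_subset _ _ hf1 hg1 h.1 h.2 p

/-- **Soundness of `Fnl.beq` for real evaluations**: functionals equal as finite maps evaluate equally. [folklore] -/
theorem eval_eq_of_beq (φ : ℤ × ℤ × ℤ → V) (f g : Fnl) (h : Fnl.beq f g = true) : eval φ f = eval φ g := by
  classical
  rw [eval_eq_sum_wt φ f (keys f ++ keys g).toFinset fun q hq =>
      List.mem_toFinset.2 (List.mem_append_left _ (List.mem_map.2 ⟨q, hq, rfl⟩)),
    eval_eq_sum_wt φ g (keys f ++ keys g).toFinset fun q hq =>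
      List.mem_toFinset.2 (List.mem_append_right _ (List.mem_map.2 ⟨q, hq, rfl⟩))]
  exact Finset.sum_congr rfl fun p _ => by rw [wt_eq_of_beq f g h p]

/-! ## The affine interpolant of a sub-tetrahedron -/

omit [Module ℝ V] in
/-- Difference of two list sums with the same index list. [folklore] -/
theorem sum_map_sub {β : Type*} (L : List β) (f g : β → V) :
    (L.map f).sum - (L.map g).sum = (L.map fun b => f b - g b).sum := by
  induction L with
  | nil => simp
  | cons b L ih => simp only [List.map_cons, List.sum_cons, ← ih]; abel

/-- The rational identity behind affinity: `⟨ĝ, (μ' − P) ⟩ − ⟨ĝ, (μ − P)⟩ = ⟨ĝ, μ' − μ⟩` in shifted coordinates. [folklore] -/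
theorem dot_sub_sub (g : ℤ × ℤ × ℤ) (N : ℤ × ℤ) (P μ μ' : Q3) :
    Q3.dot (gradQ g) (Q3.sub ⟨μ'.x - N.1, μ'.y - N.2, μ'.z⟩ P) -
        Q3.dot (gradQ g) (Q3.sub ⟨μ.x - N.1, μ.y - N.2, μ.z⟩ P) =
      Q3.dot (gradQ g) (Q3.sub μ' μ) := by
  simp only [Q3.dot, Q3.sub, gradQ]
  ring

/-- **Affinity of the interpolation functional**: for the sub-tetrahedron `t` of cube `N`,
`eval φ (tetFnl N t μ') − eval φ (tetFnl N t μ) = Σ_{(v, ĝ) ∈ subTet t} ⟨ĝ, μ' − μ⟩ • φ (N + v)`. [folklore] -/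
theorem eval_tetFnl_sub (φ : ℤ × ℤ × ℤ → V) (N : ℤ × ℤ) (t : ℕ) (μ μ' : Q3) :
    eval φ (tetFnl N t μ') - eval φ (tetFnl N t μ) =
      ((subTet t).map fun vg => (Q3.dot (gradQ vg.2) (Q3.sub μ' μ) : ℝ) •
        φ (N.1 + ((vg.1.1 : ℕ) : ℤ), N.2 + ((vg.1.2.1 : ℕ) : ℤ), ((vg.1.2.2 : ℕ) : ℤ))).sum := by
  unfold tetFnl
  rcases h : subTet t with _ | ⟨⟨v0, g0⟩, rest⟩
  · simp [bary, h, eval]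
  · simp only [bary, h, List.map_cons, List.map_map, eval_cons, List.sum_cons]
    have hrest : ∀ ν : Q3, eval φ (rest.map ((fun vl : Corner × ℚ =>
        ((N.1 + ((vl.1.1 : ℕ) : ℤ), N.2 + ((vl.1.2.1 : ℕ) : ℤ), ((vl.1.2.2 : ℕ) : ℤ)), vl.2)) ∘
          fun vg : Corner × ℤ × ℤ × ℤ => (vg.1, Q3.dot (gradQ vg.2) (Q3.sub ν (cornerQ v0))))) =
        (rest.map fun vg : Corner × ℤ × ℤ × ℤ => (Q3.dot (gradQ vg.2) (Q3.sub ν (cornerQ v0)) : ℝ) •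
          φ (N.1 + ((vg.1.1 : ℕ) : ℤ), N.2 + ((vg.1.2.1 : ℕ) : ℤ), ((vg.1.2.2 : ℕ) : ℤ))).sum := by
      intro ν
      simp [eval, List.map_map, Function.comp_def]
    rw [hrest, hrest, add_sub_add_comm, sum_map_sub, ← sub_smul, ← Rat.cast_sub, add_sub_add_right_eq_sub,
      dot_sub_sub]
    congr 1
    refine congrArg List.sum (List.map_congr_left fun vg _ => ?_)
    rw [← sub_smul, ← Rat.cast_sub, dot_sub_sub]

/-! ## Telescoping inside a slab -/

/-- The interpolation functional of the piece `p` at parameter `t`. [folklore] -/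
def pieceFnl (E D : Q3) (p : Piece) (t : ℚ) : Fnl := tetFnl p.cube p.tet (pointAt E D t)

/-- Telescoping of consecutive pieces whose junction functionals agree as finite maps. [folklore] -/
theorem telescope_aux (φ : ℤ × ℤ × ℤ → V) (E D : Q3) (p : Piece) (rest : List Piece)
    (h : (List.zip (p :: rest) rest).all (fun pq => decide (pq.1.s1 = pq.2.s0) &&
      Fnl.beq (tetFnl pq.1.cube pq.1.tet (pointAt E D pq.1.s1))
        (tetFnl pq.2.cube pq.2.tet (pointAt E D pq.2.s0))) = true) :
    ((p :: rest).map fun r => eval φ (pieceFnl E D r r.s1) - eval φ (pieceFnl E D r r.s0)).sum =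
      eval φ (pieceFnl E D ((p :: rest).getLastD p) ((p :: rest).getLastD p).s1) -
        eval φ (pieceFnl E D p p.s0) := by
  induction rest generalizing p with
  | nil => simp
  | cons q rest ih =>
    rw [List.zip_cons_cons, List.all_cons, Bool.and_eq_true, Bool.and_eq_true] at h
    obtain ⟨⟨-, hbeq⟩, h2⟩ := h
    rw [List.map_cons, List.sum_cons, ih q h2, List.getLastD_cons, List.getLastD_cons, List.getLastD_cons]
    have hj : eval φ (pieceFnl E D p p.s1) = eval φ (pieceFnl E D q q.s0) := eval_eq_of_beq φ _ _ hbeq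
    rw [hj]
    abel

/-- **Telescoping from `checkPieces`**: the sum over the pieces of the jumps of their affine interpolants is
`eval (exitFnl) − eval (entryFnl)`. [folklore] -/
theorem pieces_telescope (φ : ℤ × ℤ × ℤ → V) (E D : Q3) (ps : List Piece) (h : checkPieces E D ps = true) :
    (ps.map fun r => eval φ (pieceFnl E D r r.s1) - eval φ (pieceFnl E D r r.s0)).sum =
      eval φ (exitFnl E D ps) - eval φ (entryFnl E D ps) := by
  rcases ps with _ | ⟨p, rest⟩
  · simp [checkPieces] at h
  · simp only [checkPieces, Bool.and_eq_true] at h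
    obtain ⟨-, h⟩ := h
    simpa [exitFnl, entryFnl, pieceFnl] using telescope_aux φ E D p rest h

end StubChain

/-! ## Anchor -/

open StubChain in
/-- Registered anchor of this helper file (`stub_chainIdentityAux1`): a unit test of the total weight `wt`
(`addPt` merges the repeated point, total weight `1 + 2 = 3`, the other point keeps `5`). [folklore] -/
theorem stub_chainIdentityAux1 :
    StubChain.wt (Fnl.addPt [((0, 0, 0), 1), ((1, 0, 0), 5)] (0, 0, 0) 2) (0, 0, 0) = 3 ∧
      StubChain.wt (Fnl.addPt [((0, 0, 0), 1), ((1, 0, 0), 5)] (0, 0, 0) 2) (1, 0, 0) = 5 := by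
  have h := (addPt_spec [((0, 0, 0), 1), ((1, 0, 0), 5)] (by decide) (0, 0, 0) 2).2.2
  refine ⟨?_, ?_⟩ <;> rw [h] <;> norm_num [wt]

end Summit.AtomisticToContinuum.Crystallization.Theorems.UniformPolytypeStabilityCells

end
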